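import Summits.Ventures.Crystal3D.Theses.StickyWulffConstant

/-!
# `PolycrystalWulffBound`: grains with the same lattice have the same Wulff body

Route `StickyWulffConstant` of the venture `Summits/Ventures/Crystal3D`, crux `PolycrystalWulffBound`
(item `stmt-Ventures-19482`). The crux's tension in orientation `A` is
`ν ↦ Φ(A⁻¹ν)`, `Φ(ν) = (√2/4) Σ_{w ∈ Λ₀, ‖w‖ = 1} |⟪w, ν⟫|`, and its Wulff body is
`W_A = {y | ∀ ν, ⟪y, ν⟫ ≤ Φ(A⁻¹ν)}`. Both depend on `A` only through the rotated lattice `A(Λ₀)`: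
`Φ(A⁻¹ν) = (√2/4) Σ_{u ∈ A(Λ₀), ‖u‖ = 1} |⟪u, ν⟫|` (`shellSum_symm_eq_finsum_image`). Hence two
frames with `A₁(Λ₀) = A₂(Λ₀)` (the crux's "equal lattices", whose mutual walls are free) have the
same tension and the same Wulff body (`phiBarlow_symm_eq_of_image_eq`, `wulffBody_eq_of_image_eq`) —
the input for MERGING equal-orientation grains (planner's support lemma P₃). WHAT THIS IS NOT: the
merging identity for the interface terms (that needs additivity of `ι_K` over disjoint unions).
-/

noncomputable section

namespace Summit.Ventures.Crystal3D.Theorems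

open Set
open scoped RealInnerProductSpace
open Literature.MathematicalPhysics.StatisticalMechanics (fccStacking)

/-- The crux's tension in orientation `A`, rewritten over the rotated shell:
`Σ_{w ∈ Λ₀, ‖w‖=1} |⟪w, A⁻¹ν⟫| = Σ_{u ∈ A(Λ₀), ‖u‖=1} |⟪u, ν⟫|`. -/
theorem shellSum_symm_eq_finsum_image
    (A : EuclideanSpace ℝ (Fin 3) ≃ₗᵢ[ℝ] EuclideanSpace ℝ (Fin 3)) (ν : EuclideanSpace ℝ (Fin 3)) :
    ∑ᶠ w ∈ {w | w ∈ fccStacking 1 (Real.sqrt (2 / 3)) ∧ ‖w‖ = 1}, |⟪w, A.symm ν⟫| =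
      ∑ᶠ u ∈ {u | u ∈ A '' fccStacking 1 (Real.sqrt (2 / 3)) ∧ ‖u‖ = 1}, |⟪u, ν⟫| := by
  have hset : {u | u ∈ A '' fccStacking 1 (Real.sqrt (2 / 3)) ∧ ‖u‖ = 1} =
      A '' {w | w ∈ fccStacking 1 (Real.sqrt (2 / 3)) ∧ ‖w‖ = 1} := by
    ext u
    constructor
    · rintro ⟨⟨w, hw, rfl⟩, hu⟩
      exact ⟨w, ⟨hw, by simpa using hu⟩, rfl⟩
    · rintro ⟨w, ⟨hw, hn⟩, rfl⟩
      exact ⟨⟨w, hw, rfl⟩, by simpa using hn⟩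
  rw [hset, finsum_mem_image A.injective.injOn]
  refine finsum_congr fun w => finsum_congr fun _ => ?_
  rw [LinearIsometryEquiv.inner_map_eq_flip]

/-- **Equal lattices have equal tension**: if `A₁(Λ₀) = A₂(Λ₀)` then
`Φ(A₁⁻¹ν) = Φ(A₂⁻¹ν)` for every `ν` (the crux's `Φ`, written out). -/
theorem phiBarlow_symm_eq_of_image_eq
    {A₁ A₂ : EuclideanSpace ℝ (Fin 3) ≃ₗᵢ[ℝ] EuclideanSpace ℝ (Fin 3)}
    (h : A₁ '' fccStacking 1 (Real.sqrt (2 / 3)) = A₂ '' fccStacking 1 (Real.sqrt (2 / 3)))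
    (ν : EuclideanSpace ℝ (Fin 3)) :
    Real.sqrt 2 / 4 * ∑ᶠ w ∈ {w | w ∈ fccStacking 1 (Real.sqrt (2 / 3)) ∧ ‖w‖ = 1},
        |⟪w, A₁.symm ν⟫| =
      Real.sqrt 2 / 4 * ∑ᶠ w ∈ {w | w ∈ fccStacking 1 (Real.sqrt (2 / 3)) ∧ ‖w‖ = 1},
        |⟪w, A₂.symm ν⟫| := by
  rw [shellSum_symm_eq_finsum_image, shellSum_symm_eq_finsum_image, h]

/-- **Equal lattices have equal Wulff bodies**: if `A₁(Λ₀) = A₂(Λ₀)` then `W_{A₁} = W_{A₂}` for the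
crux's `W_A = {y | ∀ ν, ⟪y, ν⟫ ≤ Φ(A⁻¹ν)}` (so the two grains' exterior energies are measured by the
same anisotropic perimeter and the grains can be merged). -/
theorem wulffBody_eq_of_image_eq
    {A₁ A₂ : EuclideanSpace ℝ (Fin 3) ≃ₗᵢ[ℝ] EuclideanSpace ℝ (Fin 3)}
    (h : A₁ '' fccStacking 1 (Real.sqrt (2 / 3)) = A₂ '' fccStacking 1 (Real.sqrt (2 / 3))) :
    {y : EuclideanSpace ℝ (Fin 3) | ∀ ν : EuclideanSpace ℝ (Fin 3), ⟪y, ν⟫ ≤ Real.sqrt 2 / 4 *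
        ∑ᶠ w ∈ {w | w ∈ fccStacking 1 (Real.sqrt (2 / 3)) ∧ ‖w‖ = 1}, |⟪w, A₁.symm ν⟫|} =
      {y : EuclideanSpace ℝ (Fin 3) | ∀ ν : EuclideanSpace ℝ (Fin 3), ⟪y, ν⟫ ≤ Real.sqrt 2 / 4 *
        ∑ᶠ w ∈ {w | w ∈ fccStacking 1 (Real.sqrt (2 / 3)) ∧ ‖w‖ = 1}, |⟪w, A₂.symm ν⟫|} := by
  ext y
  rw [mem_setOf_eq, mem_setOf_eq]
  exact forall_congr' fun ν => by rw [phiBarlow_symm_eq_of_image_eq h ν]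

end Summit.Ventures.Crystal3D.Theorems

end
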